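import Summits.Ventures.GridStability.Models.InverterBridgesSMIB
import Summits.Ventures.GridStability.Bench.SMIBDeg2AK13postD10Roa

/-!
# GridStability/Models/InverterDroopSMIBRoa — the G1.SMIB ROA theorem, read on the droop / VSM grid-forming inverter model

Cell `gridfusion` (LADDER-GRIDFUSION, rung G3 «inverter models» = APEX LINE, director RULINGS 3 (1);
seat model-3; `plan/PARTITION.md` §0 row `Models/`, A12 «second typist IMPORTS»). This file
contains NO new analysis and NO new certificate: it TRANSPORTS the kernel-checked G1.SMIB result
`Bench.SMIB.deg2_A_K13postD10_smib_roa` (lyap-1 / sos-5, `Bench/SMIBDeg2AK13postD10Roa.lean`,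
stated for ANY `Models.SMIB` record with the instance's data relations) along the exact model
bridge `InverterDroop.ReducedParams.toGridSMIB` / `toGridState` (p462458): the reduced
droop-controlled-converter-vs-infinite-bus model [cite: Qoria2020, eq. (III-46) with (V-13)] IS that
SMIB record with `M = 1/(k_i ω_c)`, `D = 1/k_i` [cite: SchifferEtAl2014, Remark 3.3], and its
solutions are carried to SMIB solutions (`isSolutionOn_toGridSMIB`).

THREE COLUMNS. CERTIFIED (kernel, Bench file p462357/p462567, unchanged): the four polynomial
identities of instance SMIB-K13post-D10 (deg-2 `V`, level `19/8`, toolchain A). MODELLED: the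
conclusions below are about the reduced droop-inverter MODEL `InverterDroop.ReducedParams`
(MODEL-VALIDITY MV-6D: inner loops, filter/line/dc-side dynamics, current limits, voltage dynamics
ABSENT; infinite bus) resp. the VSM model (MV-6V), for ANY converter data satisfying the three
rational relations `k_i ω_c P_max cos δ^s = 532761715096/15538499375`,
`k_i ω_c P_max sin δ^s = 4303847457/88791425`, `ω_c = 10/7` [rad/s] (plus the power balance
`P_max sin δ^s = p*` and `ω_set = ω_e`) — i.e. a converter whose virtual inertia / droop damping /
operating point coincide with the Kundur Ex. 13 post-fault plant of record (MV-1 + MV-P + MV-KD read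
as control gains). Whether a realistic converter tuning realises these numbers is a DATA question
(model-4 custody; printed converter data e.g. [cite: KunduEtAl2019] §V, Qoria2020 tables) — this
file only shows, in the kernel, that the G1.SMIB pipeline output IS an inverter-model statement
with no new ingredient (memo §4/§5: rung G3.a = G1.SMIB relabelled). VALIDATED: nothing. No
sentence here says a converter or a grid is stable; «region of attraction» = the stated set of
initial conditions OF THE MODEL is carried to the model's synchronous equilibrium `(δ^s, ω_e)`.
-/

noncomputable section

open Real Set Filter Topology
open Summit.Ventures.GridStability.Bench.SMIB

namespace Summit.Ventures.GridStability.Models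

namespace InverterDroop.ReducedParams

variable (P : InverterDroop.ReducedParams)

/-- **G1.SMIB-roa on the droop grid-forming inverter model.** Let the reduced droop-converter model
`P` (`ω_set = ω_e`, nonzero `ω_b, k_i, ω_c`) have data matching instance SMIB-K13post-D10 in
converter gains (`toGridSMIB_a/_b/_d`): `k_i ω_c P_max cos δ^s = 532761715096/15538499375`,
`k_i ω_c P_max sin δ^s = 4303847457/88791425`, `ω_c = 10/7`, `P_max sin δ^s = p*`. Then for every
`0 < γ ≤ 19/8` and every solution `(δ, ω)` of the model (`IsSolution`: derivatives at all times)
whose initial recast state `(sin u₀, 1 − cos u₀, Ω₀)`, `u = δ − δ^s`, `Ω = ω_b(ω − ω_e)`, has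
`V ≤ γ` and `|u₀| < π`: for all `t ≥ 0` the certified `V` stays `≤ γ` and `|u t| < π` (no pole
slip of the converter angle), and `(δ t, ω_b(ω t − ω_e)) → (δ^s, 0)`. Transport of
`Bench.SMIB.deg2_A_K13postD10_smib_roa` along `toGridSMIB`; MODELLED: MV-6D. [folklore] -/
theorem deg2_A_K13postD10_droop_roa (hb : P.ωb ≠ 0) (hi : P.ki ≠ 0) (hc : P.ωc ≠ 0)
    (hω : P.ωset = P.ωe) {δs : ℝ}
    (ha : ((532761715096/15538499375 : ℚ) : ℝ) = P.ki * P.ωc * P.Pmax * cos δs)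
    (hb' : ((4303847457/88791425 : ℚ) : ℝ) = P.ki * P.ωc * P.Pmax * sin δs)
    (hd : ((10/7 : ℚ) : ℝ) = P.ωc) (hP : P.Pmax * sin δs = P.pref)
    {γ : ℝ} (hγ0 : 0 < γ) (hγ : γ ≤ deg2_A_K13postD10_level)
    {δ ω : ℝ → ℝ} (h : P.IsSolution δ ω)
    (h0V : deg2_A_K13postD10_V (sin (δ 0 - δs)) (1 - cos (δ 0 - δs)) (P.ωb * (ω 0 - P.ωe)) ≤ γ)
    (h0win : |δ 0 - δs| < π) :
    (∀ t, 0 ≤ t →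
        deg2_A_K13postD10_V (sin (δ t - δs)) (1 - cos (δ t - δs)) (P.ωb * (ω t - P.ωe)) ≤ γ ∧
          |δ t - δs| < π) ∧
      Tendsto (fun t => (δ t, P.ωb * (ω t - P.ωe))) atTop (𝓝 (δs, 0)) := by
  have hM := P.toGridSMIB_M_ne_zero hi hc
  have ha' : ((532761715096/15538499375 : ℚ) : ℝ)
      = P.toGridSMIB.PM * cos (δs - P.toGridSMIB.γ) / P.toGridSMIB.M := by rw [P.toGridSMIB_a, ha]
  have hb'' : ((4303847457/88791425 : ℚ) : ℝ)
      = P.toGridSMIB.PM * sin (δs - P.toGridSMIB.γ) / P.toGridSMIB.M := by rw [P.toGridSMIB_b, hb']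
  have hd' : ((10/7 : ℚ) : ℝ) = P.toGridSMIB.D / P.toGridSMIB.M := by rw [P.toGridSMIB_d hi, hd]
  have hP' : P.toGridSMIB.IsEquilibrium δs := (P.isEquilibrium_toGridSMIB_iff δs).2 hP
  have hx : P.toGridSMIB.IsSolutionOn (fun t => P.toGridState (δ t, ω t)) (Ici 0) :=
    P.isSolutionOn_toGridSMIB hb hi hc hω h (Ici 0)
  have h := deg2_A_K13postD10_smib_roa P.toGridSMIB hM ha' hb'' hd' hP' hγ0 hγ hx
    (by simpa [toGridState] using h0V) (by simpa [toGridState] using h0win)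
  simpa [toGridState] using h

/-- Corollary in the converter's own per-unit frequency: under the same hypotheses the control
frequency returns to the bus frequency, `ω t → ω_e` (from `Ω = ω_b(ω − ω_e) → 0`, `ω_b ≠ 0`).
MODELLED: MV-6D. [folklore] -/
theorem deg2_A_K13postD10_droop_freq_tendsto (hb : P.ωb ≠ 0) (hi : P.ki ≠ 0) (hc : P.ωc ≠ 0)
    (hω : P.ωset = P.ωe) {δs : ℝ}
    (ha : ((532761715096/15538499375 : ℚ) : ℝ) = P.ki * P.ωc * P.Pmax * cos δs)
    (hb' : ((4303847457/88791425 : ℚ) : ℝ) = P.ki * P.ωc * P.Pmax * sin δs)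
    (hd : ((10/7 : ℚ) : ℝ) = P.ωc) (hP : P.Pmax * sin δs = P.pref)
    {γ : ℝ} (hγ0 : 0 < γ) (hγ : γ ≤ deg2_A_K13postD10_level)
    {δ ω : ℝ → ℝ} (h : P.IsSolution δ ω)
    (h0V : deg2_A_K13postD10_V (sin (δ 0 - δs)) (1 - cos (δ 0 - δs)) (P.ωb * (ω 0 - P.ωe)) ≤ γ)
    (h0win : |δ 0 - δs| < π) :
    Tendsto δ atTop (𝓝 δs) ∧ Tendsto ω atTop (𝓝 P.ωe) := by
  obtain ⟨-, hlim⟩ := P.deg2_A_K13postD10_droop_roa hb hi hc hω ha hb' hd hP hγ0 hγ h h0V h0win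
  have hδ : Tendsto δ atTop (𝓝 δs) := by
    simpa using hlim.fst_nhds
  have hΩ : Tendsto (fun t => P.ωb * (ω t - P.ωe)) atTop (𝓝 0) := by
    simpa using hlim.snd_nhds
  refine ⟨hδ, ?_⟩
  have hω' : Tendsto (fun t => P.ωb⁻¹ * (P.ωb * (ω t - P.ωe)) + P.ωe) atTop (𝓝 (P.ωb⁻¹ * 0 + P.ωe)) :=
    (hΩ.const_mul P.ωb⁻¹).add_const P.ωe
  have heq : (fun t => P.ωb⁻¹ * (P.ωb * (ω t - P.ωe)) + P.ωe) = ω := by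
    funext t
    field_simp
    ring
  rw [heq] at hω'
  simpa using hω'

end InverterDroop.ReducedParams

namespace InverterVSM.VsmOuterLoop

variable (V : InverterVSM.VsmOuterLoop)

/-- **G1.SMIB-roa on the VSM model** [cite: HenriquezAuba2022, eqs. (2.59a)–(2.59b)] closed with
`p_e = P_max sin θ`, via `toReduced` (k_i = Ω_b k_p, ω_c = 1/(M k_p)): data relations
`(Ω_b/M) P_max cos θ^s = 532761715096/15538499375`, `(Ω_b/M) P_max sin θ^s = 4303847457/88791425`,
`1/(M k_p) = 10/7`, `P_max sin θ^s = p*`, `ω* = ω_s`, nonzero `Ω_b, M, k_p`; conclusion as for the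
droop model with `Ω = Ω_b(ω − ω_s)`. MODELLED: MV-6V. [folklore] -/
theorem deg2_A_K13postD10_vsm_roa (hb : V.Ωb ≠ 0) (hM : V.M ≠ 0) (hk : V.kp ≠ 0)
    (hω : V.ωref = V.ωs) (Pmax : ℝ) {θs : ℝ}
    (ha : ((532761715096/15538499375 : ℚ) : ℝ) = V.Ωb / V.M * Pmax * cos θs)
    (hb' : ((4303847457/88791425 : ℚ) : ℝ) = V.Ωb / V.M * Pmax * sin θs)
    (hd : ((10/7 : ℚ) : ℝ) = 1 / (V.M * V.kp)) (hP : Pmax * sin θs = V.pref)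
    {γ : ℝ} (hγ0 : 0 < γ) (hγ : γ ≤ deg2_A_K13postD10_level)
    {θ ω : ℝ → ℝ} (h : V.IsSolution Pmax θ ω)
    (h0V : deg2_A_K13postD10_V (sin (θ 0 - θs)) (1 - cos (θ 0 - θs)) (V.Ωb * (ω 0 - V.ωs)) ≤ γ)
    (h0win : |θ 0 - θs| < π) :
    (∀ t, 0 ≤ t →
        deg2_A_K13postD10_V (sin (θ t - θs)) (1 - cos (θ t - θs)) (V.Ωb * (ω t - V.ωs)) ≤ γ ∧
          |θ t - θs| < π) ∧
      Tendsto (fun t => (θ t, V.Ωb * (ω t - V.ωs))) atTop (𝓝 (θs, 0)) := by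
  have h' : (V.toReduced Pmax).IsSolution θ ω := (V.isSolution_iff_toReduced hb hM hk Pmax θ ω).1 h
  have hi : (V.toReduced Pmax).ki ≠ 0 := mul_ne_zero hb hk
  have hc : (V.toReduced Pmax).ωc ≠ 0 := by
    simp only [toReduced]
    exact one_div_ne_zero (mul_ne_zero hM hk)
  have hgain : (V.toReduced Pmax).ki * (V.toReduced Pmax).ωc = V.Ωb / V.M := by
    simp only [toReduced]
    field_simp
  have ha' : ((532761715096/15538499375 : ℚ) : ℝ) = (V.toReduced Pmax).ki * (V.toReduced Pmax).ωc
      * (V.toReduced Pmax).Pmax * cos θs := by rw [hgain, ha]; rfl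
  have hb'' : ((4303847457/88791425 : ℚ) : ℝ) = (V.toReduced Pmax).ki * (V.toReduced Pmax).ωc
      * (V.toReduced Pmax).Pmax * sin θs := by rw [hgain, hb']; rfl
  have hd' : ((10/7 : ℚ) : ℝ) = (V.toReduced Pmax).ωc := by rw [hd]; rfl
  have hP' : (V.toReduced Pmax).Pmax * sin θs = (V.toReduced Pmax).pref := hP
  have := (V.toReduced Pmax).deg2_A_K13postD10_droop_roa hb hi hc hω ha' hb'' hd' hP' hγ0 hγ h'
    (by simpa [toReduced] using h0V) h0win
  simpa [toReduced] using this

end InverterVSM.VsmOuterLoop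

end Summit.Ventures.GridStability.Models

end
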